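import Literature.Computability.Cryptography.HILLHashedFunction
import HarnessLib

/-!
# The greedy selection of HILL's Lemma 6.3.2: the adaptive hybrid, abstractly (Håstad–Impagliazzo–Levin–Luby 1999, §6.3)

HILL 1999 (SIAM J. Comput. 28; authors' preprint `galaxy-pdf--8752169249696178760`), §6.3, proof of Lemma 6.3.2
(the uniform reduction from a distinguisher of `𝒟`/`ℰ` to a distinguisher of one hidden bit), Phase 1:

> Stage `j = 1, …, kₙ` works as follows: Randomly choose `cⱼ ∈ {0,1}` so that `cⱼ = 1` with probability `pₙ`.
> Choose `x̂₁, …, x̂_τ ∈_𝒰 {0,1}ⁿ` and `î₁, …, î_τ` … For each `m ∈ {1, …, τ}`, define `w_m = ⟨x̂_m, î_m⟩` and let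
> `𝒟^{(j−1)}_{cⱼ}(w_m)` be the same as `𝒟^{(j−1)}` except that `⟨X'ⱼ, I'ⱼ⟩` is fixed to `w_m` and the `j`th input bit of
> `h'` is set to `x̂_m ⊙ Y'ⱼ` if `cⱼ = 0`, `Bⱼ` if `cⱼ = 1` … Using `A` and sampling … produce an estimate `Δ` so that
> `Pr[|Δ − δ| > ρ] ≤ 2⁻ⁿ`. Let `m₀` be the index for which `Δ(w_{m₀})` is maximized. Set `⟨x'ⱼ, i'ⱼ⟩ = w_{m₀}` …

and the analysis (b): `E[δ^{(j)} − δ^{(j+1)}] ≤ ε^{(j)} + 4ρ`, resting on "with probability at least `1 − 2⁻ⁿ`, at least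
`n/ρ` of the `w_m`'s are in `𝒯` [resp. `𝒯̄`] … `Pr[max_m δ_c(w_m) ≥ max{E[δ_c(W)], E[δ_c(W̄)]} − ρ] ≥ 1 − 2⁻ⁿ`", and
the telescoping `δₙ/2 < Σⱼ E[δ^{(j)} − δ^{(j+1)}] ≤ 4kₙρ + E[Σⱼ ε^{(j)}]`.

This file isolates that argument as **pure finite probability**, with the gap function `δ` (in HILL:
`Pr[A(𝒟^{(·)}) = 1] − Pr[A(ℰ^{(·)}) = 1]` as a function of the template of fixings) and the estimator `est` (in HILL:
an empirical average over fresh samples) ABSTRACT, subject to the two properties the concrete ones have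
(`HILL.Greedy.Laws`): Fubini in the next free position (`δ τ = avg_w δ(τ · (w, real))`) and estimation within `ρ`
except with probability `η`. Templates are lists of fixings `(w, c)` (`c = true`: the block of that position is
replaced by fresh random bits); the stage rule `HILL.Greedy.stage` reads its coins as `c`-coins followed by `τn`
candidate blocks `w_m ‖ (estimation coins)` and keeps the FIRST maximiser of the estimates (the tie-breaking the
machine of `HILLGreedyMachine.lean` implements); the process `templateOf j` consumes `j` stage blocks.

Main results: `sampling_lemma` (a `[−1,1]`-valued function exceeds its mean minus `ρ` on a `ρ/3` fraction),
`stage_ge` (analysis (b) for one stage: `E[δ(stage τ)] ≥ p·V₁(τ) + (1−p)·V₀(τ) − 3ρ − 2(f₁ + f₂)`),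
`delta_split` (`δ τ = p(ε τ + V₁ τ) + (1−p) V₀ τ`), `sum_eps_ge` (telescoping over `k` stages) and
**`exists_good_stage`** (some stage `j* < k` has `E[ε(τ_{j*})] ≥ (δ(∅) − E[δ(τ_k)] − k ρ')/(p k)`) — the
quantity the phase-2 machine with advice `j*` turns into a distinguishing advantage for one hidden block.

## References

* J. Håstad, R. Impagliazzo, L. A. Levin, M. Luby, SIAM J. Comput. 28 (1999), §6.3: Lemma 6.3.2, its proof
  (Phase 1, claims (a)–(b), the telescoping inequality (9)).
-/

namespace Literature.Computability.Cryptography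

open Finset Complexity

namespace HILL

namespace Greedy

/-! ### Small tools on uniform averages -/

/-- A function of a suffix of the coins: the leading coins average out. [folklore] -/
private theorem uniformAvg_drop (a b : ℕ) (G : List Bool → ℝ) : uniformAvg (a + b) (fun r => G (r.drop a)) = uniformAvg b G := by
  have h := uniformAvg_add a b (fun _ w => G w)
  simp only [uniformAvg_const] at h
  exact h

/-- A function of a prefix of the coins: the trailing coins average out. [folklore] -/
private theorem uniformAvg_take (a b : ℕ) (G : List Bool → ℝ) : uniformAvg (a + b) (fun r => G (r.take a)) = uniformAvg a G := by
  have h := uniformAvg_add a b (fun u _ => G u)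
  simp only [uniformAvg_const] at h
  exact h

/-- Uniform averages are additive. [folklore] -/
private theorem uniformAvg_add_fun (k : ℕ) (F G : List Bool → ℝ) :
    uniformAvg k (fun r => F r + G r) = uniformAvg k F + uniformAvg k G := by
  unfold uniformAvg; rw [← add_div, Finset.sum_add_distrib]

/-- Uniform averages commute with subtraction. [folklore] -/
private theorem uniformAvg_sub_fun (k : ℕ) (F G : List Bool → ℝ) :
    uniformAvg k (fun r => F r - G r) = uniformAvg k F - uniformAvg k G := by
  unfold uniformAvg; rw [← sub_div, Finset.sum_sub_distrib]

/-- Uniform averages commute with finite sums. [folklore] -/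
private theorem uniformAvg_finset_sum {ι : Type*} (s : Finset ι) (k : ℕ) (F : ι → List Bool → ℝ) :
    uniformAvg k (fun r => ∑ i ∈ s, F i r) = ∑ i ∈ s, uniformAvg k (F i) := by
  unfold uniformAvg
  rw [Finset.sum_comm, Finset.sum_div]

/-- The uniform average as a sum over vectors. [folklore] -/
private theorem uniformAvg_eq_sum (n : ℕ) (G : List Bool → ℝ) : uniformAvg n G = (∑ x : List.Vector Bool n, G x.toList) / 2 ^ n := rfl

/-- Lower bound of a uniform average by a pointwise bound on strings of the right length. [folklore] -/
private theorem le_uniformAvg_of_forall {k : ℕ} {G : List Bool → ℝ} {c : ℝ} (h : ∀ r : List Bool, r.length = k → c ≤ G r) :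
    c ≤ uniformAvg k G := by
  have := uniformAvg_mono (k := k) (f := fun _ => c) (g := G) h
  rwa [uniformAvg_const] at this

/-! ### Blocks of coins: product and marginal laws -/

/-- The `m`-th block of length `L` of a string. [folklore] -/
def blkL (L m : ℕ) (r : List Bool) : List Bool := (r.drop (m * L)).take L

/-- Indicator of a proposition. [folklore] -/
noncomputable def ind (P : Prop) : ℝ := by classical exact if P then 1 else 0

/-- `0 ≤ ind P ≤ 1`. [folklore] -/
theorem ind_nonneg (P : Prop) : 0 ≤ ind P := by unfold ind; split_ifs <;> norm_num
/-- `ind P ≤ 1`. [folklore] -/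
private theorem ind_le_one (P : Prop) : ind P ≤ 1 := by unfold ind; split_ifs <;> norm_num
/-- `ind` of a true proposition. [folklore] -/
theorem ind_of_true {P : Prop} (h : P) : ind P = 1 := by unfold ind; rw [if_pos h]
/-- `ind` of a false proposition. [folklore] -/
theorem ind_of_false {P : Prop} (h : ¬ P) : ind P = 0 := by unfold ind; rw [if_neg h]
/-- `ind (P ∧ R) = ind P · ind R`. [folklore] -/
private theorem ind_and (P R : Prop) : ind (P ∧ R) = ind P * ind R := by
  unfold ind; by_cases hP : P <;> by_cases hR : R <;> simp [hP, hR]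
/-- Union bound for indicators. [folklore] -/
theorem ind_exists_le (n : ℕ) (B : ℕ → Prop) : ind (∃ m < n, B m) ≤ ∑ m ∈ Finset.range n, ind (B m) := by
  classical
  by_cases h : ∃ m < n, B m
  · obtain ⟨m, hm, hB⟩ := h
    rw [ind_of_true ⟨m, hm, hB⟩]
    calc (1 : ℝ) = ind (B m) := (ind_of_true hB).symm
      _ ≤ ∑ m ∈ Finset.range n, ind (B m) := Finset.single_le_sum (fun _ _ => ind_nonneg _) (Finset.mem_range.2 hm)
  · rw [ind_of_false h]; exact Finset.sum_nonneg fun _ _ => ind_nonneg _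
/-- Complement: `ind (¬P) = 1 − ind P`. [folklore] -/
theorem ind_not (P : Prop) : ind (¬ P) = 1 - ind P := by unfold ind; by_cases hP : P <;> simp [hP]

/-- **Marginal law of one block**: a function of block `m < n` averages as over one block. [folklore] -/
theorem uniformAvg_blkL {L n m : ℕ} (hm : m < n) (G : List Bool → ℝ) :
    uniformAvg (n * L) (fun r => G (blkL L m r)) = uniformAvg L G := by
  obtain ⟨d, rfl⟩ : ∃ d, n = m + 1 + d := ⟨n - m - 1, by omega⟩
  have hsplit : (m + 1 + d) * L = m * L + (L + d * L) := by ring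
  rw [hsplit]
  unfold blkL
  rw [uniformAvg_drop (m * L) (L + d * L) (fun w => G (w.take L)), uniformAvg_take]

/-- **Product law of the blocks**: the indicator that every block satisfies `P` averages to the `n`-th power of
the one-block probability. [folklore] -/
theorem uniformAvg_forall_blkL (L : ℕ) (P : List Bool → Prop) : ∀ n : ℕ,
    uniformAvg (n * L) (fun r => ind (∀ m < n, P (blkL L m r))) = (uniformAvg L fun β => ind (P β)) ^ n
  | 0 => by
    rw [pow_zero, Nat.zero_mul]
    have : (fun r : List Bool => ind (∀ m < 0, P (blkL L m r))) = fun _ => 1 := funext fun r => ind_of_true fun m hm => absurd hm (Nat.not_lt_zero m)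
    rw [this, uniformAvg_const]
  | n + 1 => by
    have hsplit : (n + 1) * L = L + n * L := by ring
    rw [hsplit]
    -- block `0` is the first `L` coins, block `m+1` of `r` is block `m` of `r ⇂ L`
    have hfun : ∀ r : List Bool, r.length = L + n * L →
        ind (∀ m < n + 1, P (blkL L m r)) = ind (P (r.take L)) * ind (∀ m < n, P (blkL L m (r.drop L))) := by
      intro r _
      rw [← ind_and]
      unfold ind; congr 1; apply propext
      constructor
      · intro h
        refine ⟨by simpa [blkL] using h 0 (Nat.succ_pos n), fun m hm => ?_⟩
        have := h (m + 1) (by omega)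
        simpa [blkL, List.drop_drop, Nat.succ_mul, Nat.add_comm] using this
      · rintro ⟨h0, hs⟩ m hm
        rcases m with _ | m
        · simpa [blkL] using h0
        · have := hs m (by omega)
          simpa [blkL, List.drop_drop, Nat.succ_mul, Nat.add_comm] using this
    rw [uniformAvg_congr hfun, uniformAvg_add L (n * L) fun u v => ind (P u) * ind (∀ m < n, P (blkL L m v))]
    simp only [uniformAvg_const_mul]
    rw [uniformAvg_forall_blkL L P n, pow_succ]
    unfold uniformAvg
    rw [← Finset.sum_mul]
    ring

/-! ### The sampling lemma -/

/-- **Sampling lemma**: a `[−1,1]`-valued function on a nonempty finite set is at least its mean minus `ρ` on at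
least a `ρ/3` fraction of the set (`0 ≤ ρ ≤ 1`). (Behind HILL's "`Pr[max_m δ_c(w_m) ≥ E[δ_c(W)] − ρ] ≥ 1 − 2⁻ⁿ`".)
[cite: HastadImpagliazzoLevinLuby1999, Lemma 6.3.2 (proof of (b): "It then follows using Chernoff bounds that Pr[max …] is at least 1 − 2^{-n}")] -/
theorem sampling_lemma {ι : Type*} (S : Finset ι) (hS : S.Nonempty) (g : ι → ℝ) (hg : ∀ i ∈ S, |g i| ≤ 1)
    {ρ : ℝ} (hρ1 : ρ ≤ 1) :
    ρ / 3 * S.card ≤ ((S.filter fun i => (∑ j ∈ S, g j) / S.card - ρ ≤ g i).card : ℝ) := by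
  classical
  set μ := (∑ j ∈ S, g j) / S.card with hμ
  set Gd := S.filter fun i => μ - ρ ≤ g i with hGd
  have hScard : (0 : ℝ) < S.card := by exact_mod_cast hS.card_pos
  have hsum : ∑ j ∈ S, g j = μ * S.card := by rw [hμ]; field_simp
  have hμ1 : -1 ≤ μ := by
    rw [hμ, le_div_iff₀ hScard]
    calc (-1 : ℝ) * S.card = ∑ _j ∈ S, (-1 : ℝ) := by rw [Finset.sum_const, nsmul_eq_mul, mul_comm]
      _ ≤ ∑ j ∈ S, g j := Finset.sum_le_sum fun j hj => (abs_le.1 (hg j hj)).1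
  -- split the sum over the good set and its complement
  have hsplit : ∑ j ∈ S, g j = ∑ j ∈ Gd, g j + ∑ j ∈ S \ Gd, g j := by
    rw [← Finset.sum_union (Finset.disjoint_sdiff), Finset.union_sdiff_of_subset (Finset.filter_subset _ _)]
  have h1 : ∑ j ∈ Gd, g j ≤ Gd.card := by
    calc ∑ j ∈ Gd, g j ≤ ∑ _j ∈ Gd, (1 : ℝ) := Finset.sum_le_sum fun j hj => (abs_le.1 (hg j (Finset.mem_of_mem_filter j hj))).2
      _ = Gd.card := by rw [Finset.sum_const, nsmul_eq_mul, mul_one]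
  have h2 : ∑ j ∈ S \ Gd, g j ≤ (S.card - Gd.card) * (μ - ρ) := by
    have hlt : ∀ j ∈ S \ Gd, g j ≤ μ - ρ := fun j hj => by
      rw [Finset.mem_sdiff, hGd, Finset.mem_filter] at hj
      push Not at hj
      exact (hj.2 hj.1).le
    calc ∑ j ∈ S \ Gd, g j ≤ ∑ _j ∈ S \ Gd, (μ - ρ) := Finset.sum_le_sum hlt
      _ = (S \ Gd).card * (μ - ρ) := by rw [Finset.sum_const, nsmul_eq_mul]
      _ = (S.card - Gd.card) * (μ - ρ) := by
          rw [Finset.card_sdiff_of_subset (Finset.filter_subset _ _)]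
          push_cast [Finset.card_le_card (Finset.filter_subset _ S)]
          ring
  have hGle : (Gd.card : ℝ) ≤ S.card := by exact_mod_cast Finset.card_le_card (Finset.filter_subset _ _)
  -- `μ |S| ≤ |Gd| + (|S| - |Gd|)(μ - ρ)` gives `ρ |S| ≤ |Gd| (1 - μ + ρ) ≤ 3 |Gd|`
  have h3 : μ * S.card ≤ Gd.card + (S.card - Gd.card) * (μ - ρ) := by rw [← hsum, hsplit]; linarith
  have hG0 : (0 : ℝ) ≤ Gd.card := Nat.cast_nonneg _
  nlinarith

/-! ### The data of the greedy process -/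

/-- **The data of the greedy selection** at one level: candidates are `N`-bit strings, `Tt` the target set
(HILL's enlarged `𝒯`), `δ` the gap function on templates of fixings, `est` the estimator (its last argument are
its own coins), `b` coins and threshold `t` for the Bernoulli choice `c = [⟦coins⟧ < t]`, `τn` candidates per
stage, `cE` estimation coins per candidate, accuracy `ρ` and failure `η` of the estimator.
[cite: HastadImpagliazzoLevinLuby1999, Lemma 6.3.2 (proof, Phase 1)] -/
structure Data (N : ℕ) where
  /-- the target set `𝒯̃` [cite: HastadImpagliazzoLevinLuby1999, §6.3] -/
  Tt : Finset (List.Vector Bool N)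
  /-- the gap function `δ` on templates [cite: HastadImpagliazzoLevinLuby1999, Lemma 6.3.2 (proof: δ^{(j)})] -/
  δ : List (List Bool × Bool) → ℝ
  /-- the estimator `Δ` [cite: HastadImpagliazzoLevinLuby1999, Lemma 6.3.2 (proof: the estimate Δ)] -/
  est : List (List Bool × Bool) → List Bool × Bool → List Bool → ℝ
  /-- number of coins of the Bernoulli choice [folklore] -/
  b : ℕ
  /-- its threshold [folklore] -/
  t : ℕ
  /-- candidates per stage (`τ`) [cite: HastadImpagliazzoLevinLuby1999, Lemma 6.3.2 (proof: τ = 64n²/ρ)] -/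
  τn : ℕ
  /-- estimation coins per candidate [folklore] -/
  cE : ℕ
  /-- accuracy [cite: HastadImpagliazzoLevinLuby1999, Lemma 6.3.2 (proof: ρ = δₙ/(16kₙ))] -/
  ρ : ℝ
  /-- failure probability of one estimate [folklore] -/
  η : ℝ

namespace Data

variable {N : ℕ} (Q : Data N)

/-- `#{0,1}^N = 2^N`. [folklore] -/
theorem card_univ_vec (N : ℕ) : (Finset.univ : Finset (List.Vector Bool N)).card = 2 ^ N := by
  rw [Finset.card_univ, card_vector, Fintype.card_bool]

/-- `δ_c(τ, w) = δ(τ · (w, c))`. [cite: HastadImpagliazzoLevinLuby1999, Lemma 6.3.2 (proof: δ^{(j-1)}_{c}(w_m))] -/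
def δc (τ : List (List Bool × Bool)) (w : List Bool) (c : Bool) : ℝ := Q.δ (τ ++ [(w, c)])

/-- The density `p = #𝒯̃ / 2^N`. [cite: HastadImpagliazzoLevinLuby1999, §6.2 eq. (5)] -/
noncomputable def p : ℝ := Q.Tt.card / 2 ^ N

/-- `V₁(τ) = E_{w ← 𝒯̃}[δ₁(τ, w)]`. [cite: HastadImpagliazzoLevinLuby1999, Lemma 6.3.2 (proof: E[δ₁^{(j)}(W)])] -/
noncomputable def V₁ (τ : List (List Bool × Bool)) : ℝ := (∑ w ∈ Q.Tt, Q.δc τ w.toList true) / Q.Tt.card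

/-- `V₀(τ) = E_{w ← 𝒯̃ᶜ}[δ₀(τ, w)]`. [cite: HastadImpagliazzoLevinLuby1999, Lemma 6.3.2 (proof: E[δ₀^{(j)}(W̄)])] -/
noncomputable def V₀ (τ : List (List Bool × Bool)) : ℝ := (∑ w ∈ Q.Ttᶜ, Q.δc τ w.toList false) / Q.Ttᶜ.card

/-- `ε(τ) = E_{w ← 𝒯̃}[δ₀(τ, w) − δ₁(τ, w)]` — the real-versus-random gap on the target set, in the context `τ`.
[cite: HastadImpagliazzoLevinLuby1999, Lemma 6.3.2 (proof: ε^{(j)} = E[δ₀^{(j)}(W) − δ₁^{(j)}(W)])] -/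
noncomputable def ε (τ : List (List Bool × Bool)) : ℝ := (∑ w ∈ Q.Tt, (Q.δc τ w.toList false - Q.δc τ w.toList true)) / Q.Tt.card

/-! ### The stage rule -/

/-- The Bernoulli choice: `c = [⟦first b coins⟧ < t]`. [cite: HastadImpagliazzoLevinLuby1999, Lemma 6.3.2 (proof: "choose c_j ∈ {0,1} so that c_j = 1 with probability p_n")] -/
def cOf (coins : List Bool) : Bool := decide (bitsToNat (coins.take Q.b) < Q.t)

/-- The `m`-th candidate block `w_m ‖ (estimation coins)` of the stage coins. [folklore] -/
def blockOf (coins : List Bool) (m : ℕ) : List Bool := ((coins.drop Q.b).drop (m * (N + Q.cE))).take (N + Q.cE)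

/-- The `m`-th candidate `w_m`. [cite: HastadImpagliazzoLevinLuby1999, Lemma 6.3.2 (proof: x̂_m, î_m)] -/
def cand (coins : List Bool) (m : ℕ) : List Bool := (Q.blockOf coins m).take N

/-- The estimation coins of the `m`-th candidate. [folklore] -/
def ceOf (coins : List Bool) (m : ℕ) : List Bool := (Q.blockOf coins m).drop N

/-- The `m`-th estimate. [cite: HastadImpagliazzoLevinLuby1999, Lemma 6.3.2 (proof: Δ(w_m))] -/
def estv (τ : List (List Bool × Bool)) (coins : List Bool) (m : ℕ) : ℝ :=
  Q.est τ (Q.cand coins m, Q.cOf coins) (Q.ceOf coins m)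

/-- **The first maximiser** of `v` on `{0, …, n−1}` (`0` for `n = 0`). [folklore] -/
noncomputable def argmaxFirst (v : ℕ → ℝ) : ℕ → ℕ
  | 0 => 0
  | n + 1 => if v (argmaxFirst v n) < v n then n else argmaxFirst v n

/-- `argmaxFirst v n < n` for `0 < n`. [folklore] -/
theorem argmaxFirst_lt (v : ℕ → ℝ) : ∀ {n : ℕ}, 0 < n → argmaxFirst v n < n
  | n + 1, _ => by
    rw [argmaxFirst]
    split_ifs with h
    · exact Nat.lt_succ_self n
    · rcases Nat.eq_zero_or_pos n with rfl | hn
      · simp [argmaxFirst]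
      · exact (argmaxFirst_lt v hn).trans (Nat.lt_succ_self n)

/-- `argmaxFirst v n` is a maximiser. [folklore] -/
theorem le_argmaxFirst (v : ℕ → ℝ) : ∀ (n m : ℕ), m < n → v m ≤ v (argmaxFirst v n)
  | n + 1, m, hm => by
    rw [argmaxFirst]
    split_ifs with h
    · rcases Nat.lt_succ_iff_lt_or_eq.1 hm with hm' | rfl
      · exact ((le_argmaxFirst v n m hm').trans h.le)
      · exact le_rfl
    · rcases Nat.lt_succ_iff_lt_or_eq.1 hm with hm' | rfl
      · exact le_argmaxFirst v n m hm'
      · exact not_lt.1 h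

/-- **The stage's choice**: the first candidate maximising the estimate, with the Bernoulli bit.
[cite: HastadImpagliazzoLevinLuby1999, Lemma 6.3.2 (proof: "Let m₀ be the index for which Δ(w_{m₀}) is maximized")] -/
noncomputable def choice (τ : List (List Bool × Bool)) (coins : List Bool) : List Bool × Bool :=
  (Q.cand coins (argmaxFirst (Q.estv τ coins) Q.τn), Q.cOf coins)

/-- **One stage**: extend the template by the choice. [cite: HastadImpagliazzoLevinLuby1999, Lemma 6.3.2 (proof, Phase 1, stage j)] -/
noncomputable def stage (τ : List (List Bool × Bool)) (coins : List Bool) : List (List Bool × Bool) := τ ++ [Q.choice τ coins]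

/-- The number of coins of one stage. [folklore] -/
def cS : ℕ := Q.b + Q.τn * (N + Q.cE)

/-- **The template after `j` stages**, read off `j` stage blocks of coins. [cite: HastadImpagliazzoLevinLuby1999, Lemma 6.3.2 (proof, Phase 1)] -/
noncomputable def templateOf : ℕ → List Bool → List (List Bool × Bool)
  | 0, _ => []
  | j + 1, cc => Q.stage (templateOf j (cc.take (j * Q.cS))) (cc.drop (j * Q.cS))

/-- `E_j[F]`: the expectation of `F` of the template after `j` stages. [folklore] -/
noncomputable def Ej (j : ℕ) (F : List (List Bool × Bool) → ℝ) : ℝ := uniformAvg (j * Q.cS) fun cc => F (Q.templateOf j cc)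

/-- `E_0[F] = F(∅)`. [folklore] -/
theorem Ej_zero (F : List (List Bool × Bool) → ℝ) : Q.Ej 0 F = F [] := by
  unfold Ej; rw [Nat.zero_mul]
  have huniv : (Finset.univ : Finset (List.Vector Bool 0)) = {List.Vector.nil} := by
    ext v; simp [List.Vector.eq_nil v]
  unfold uniformAvg
  rw [huniv, Finset.sum_singleton, pow_zero, div_one]
  rfl

/-- **The tower property**: `E_{j+1}[F] = E_j[E_stage[F ∘ stage τ]]`. [folklore] -/
theorem Ej_succ (j : ℕ) (F : List (List Bool × Bool) → ℝ) :
    Q.Ej (j + 1) F = Q.Ej j fun τ => uniformAvg Q.cS fun c => F (Q.stage τ c) := by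
  unfold Ej
  rw [Nat.succ_mul]
  exact uniformAvg_add (j * Q.cS) Q.cS fun u v => F (Q.stage (Q.templateOf j u) v)

/-- `E_j` is monotone. [folklore] -/
theorem Ej_mono (j : ℕ) {F G : List (List Bool × Bool) → ℝ} (h : ∀ τ, F τ ≤ G τ) : Q.Ej j F ≤ Q.Ej j G :=
  uniformAvg_mono fun _ _ => h _

/-- `E_j` is linear: subtraction. [folklore] -/
theorem Ej_sub (j : ℕ) (F G : List (List Bool × Bool) → ℝ) : Q.Ej j (fun τ => F τ - G τ) = Q.Ej j F - Q.Ej j G :=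
  uniformAvg_sub_fun _ _ _

/-- `E_j` of a constant multiple. [folklore] -/
theorem Ej_const_mul (j : ℕ) (c : ℝ) (F : List (List Bool × Bool) → ℝ) : Q.Ej j (fun τ => c * F τ) = c * Q.Ej j F :=
  uniformAvg_const_mul _ _

/-- `E_j` of a constant. [folklore] -/
theorem Ej_const (j : ℕ) (c : ℝ) : Q.Ej j (fun _ => c) = c := uniformAvg_const _ _

/-! ### The laws assumed of `δ` and `est` -/

/-- **The laws of the data** (what the concrete `δ`, `est` of Lemma 6.3.2 satisfy): `|δ| ≤ 1`; Fubini in the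
next free position; the estimator is `ρ`-accurate except with probability `η`; the Bernoulli parameter is the
density of `𝒯̃` (`t/2^b = #𝒯̃/2^N`, `t ≤ 2^b`); `𝒯̃` and its complement both have density `≥ pmin > 0`;
`0 ≤ ρ ≤ 1`, `0 ≤ η`, `1 ≤ τn`. [cite: HastadImpagliazzoLevinLuby1999, Lemma 6.3.2 (proof)] -/
structure Laws (Q : Data N) (pmin : ℝ) : Prop where
  abs_le : ∀ τ, |Q.δ τ| ≤ 1
  fubini : ∀ τ, Q.δ τ = uniformAvg N fun w => Q.δ (τ ++ [(w, false)])
  est_good : ∀ τ (w : List Bool) (c : Bool), w.length = N →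
    uniformAvg Q.cE (fun ce => ind (Q.ρ < |Q.est τ (w, c) ce - Q.δ (τ ++ [(w, c)])|)) ≤ Q.η
  t_le : Q.t ≤ 2 ^ Q.b
  density : (Q.t : ℝ) / 2 ^ Q.b = Q.p
  pmin_pos : 0 < pmin
  pmin_le : pmin ≤ Q.p
  pmin_le' : pmin ≤ 1 - Q.p
  ρ_nonneg : 0 ≤ Q.ρ
  ρ_le : Q.ρ ≤ 1
  η_nonneg : 0 ≤ Q.η
  τn_pos : 1 ≤ Q.τn

variable {Q} {pmin : ℝ}

/-- `0 < p`, from the laws. [folklore] -/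
theorem Laws.p_pos (h : Q.Laws pmin) : 0 < Q.p := h.pmin_pos.trans_le h.pmin_le
/-- `p < 1`, from the laws. [folklore] -/
theorem Laws.p_lt_one (h : Q.Laws pmin) : Q.p < 1 := by have := h.pmin_le'; have := h.pmin_pos; linarith
/-- `𝒯̃` is nonempty. [folklore] -/
theorem Laws.Tt_nonempty (h : Q.Laws pmin) : Q.Tt.Nonempty := by
  rw [← Finset.card_pos]
  have hp := h.p_pos
  unfold p at hp
  have h0 : (0 : ℝ) < Q.Tt.card := by
    by_contra h0; push Not at h0
    have : (Q.Tt.card : ℝ) / 2 ^ N ≤ 0 := div_nonpos_of_nonpos_of_nonneg h0 (by positivity)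
    linarith
  exact_mod_cast h0

/-- `#𝒯̃ᶜ = 2^N − #𝒯̃`. [folklore] -/
theorem card_compl_eq (Q : Data N) : Q.Ttᶜ.card = 2 ^ N - Q.Tt.card := by
  rw [Finset.card_compl, ← Finset.card_univ, card_univ_vec]

/-- `#𝒯̃ ≤ 2^N`. [folklore] -/
theorem card_Tt_le (Q : Data N) : Q.Tt.card ≤ 2 ^ N := (Finset.card_le_univ _).trans (card_univ_vec N).le

/-- `𝒯̃ᶜ` is nonempty. [folklore] -/
theorem Laws.Ttc_nonempty (h : Q.Laws pmin) : Q.Ttᶜ.Nonempty := by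
  rw [← Finset.card_pos, card_compl_eq]
  have hp := h.p_lt_one
  unfold p at hp
  rw [div_lt_one (by positivity)] at hp
  have hlt : Q.Tt.card < 2 ^ N := by exact_mod_cast hp
  omega

/-- The density of the complement is `1 − p`. [folklore] -/
theorem card_compl_div (Q : Data N) : (Q.Ttᶜ.card : ℝ) / 2 ^ N = 1 - Q.p := by
  unfold p
  rw [card_compl_eq, Nat.cast_sub Q.card_Tt_le]
  push_cast
  field_simp

/-! ### Splitting `δ` along `𝒯̃` -/

/-- **`δ τ = p (ε τ + V₁ τ) + (1 − p) V₀ τ`** (Fubini in the next position, and `{0,1}^N = 𝒯̃ ⊔ 𝒯̃ᶜ`).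
[cite: HastadImpagliazzoLevinLuby1999, Lemma 6.3.2 (proof of (b): "δ^{(j)} = pₙ E[δ₁(W)] + pₙ ε^{(j)} + (1 − pₙ) E[δ₀(W̄)]")] -/
theorem delta_split (h : Q.Laws pmin) (τ : List (List Bool × Bool)) : Q.δ τ = Q.p * (Q.ε τ + Q.V₁ τ) + (1 - Q.p) * Q.V₀ τ := by
  classical
  have hT : (0 : ℝ) < Q.Tt.card := by exact_mod_cast h.Tt_nonempty.card_pos
  have hTc : (0 : ℝ) < Q.Ttᶜ.card := by exact_mod_cast h.Ttc_nonempty.card_pos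
  have hεV : Q.ε τ + Q.V₁ τ = (∑ w ∈ Q.Tt, Q.δc τ w.toList false) / Q.Tt.card := by
    unfold ε V₁
    rw [← add_div, ← Finset.sum_add_distrib]
    congr 1
    exact Finset.sum_congr rfl fun w _ => by ring
  have hcd := card_compl_div Q
  unfold p at hcd ⊢
  rw [hεV, h.fubini τ, uniformAvg_eq_sum, V₀, ← hcd,
    ← Finset.sum_add_sum_compl Q.Tt fun w : List.Vector Bool N => Q.δ (τ ++ [(w.toList, false)])]
  unfold δc
  field_simp

/-! ### The Bernoulli choice -/

/-- Bit strings of equal length with equal values are equal. [folklore] -/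
private theorem bits_eq_of_bitsToNat_eq' : ∀ {v w : List Bool}, v.length = w.length → bitsToNat v = bitsToNat w → v = w
  | [], [], _, _ => rfl
  | [], _ :: _, h, _ => by simp at h
  | _ :: _, [], h, _ => by simp at h
  | a :: v, b :: w, h, hv => by
    simp only [List.length_cons, Nat.succ.injEq] at h
    rw [bitsToNat_cons, bitsToNat_cons] at hv
    have hab : a = b := by
      cases a <;> cases b <;> simp [Bool.toNat] at hv ⊢ <;> omega
    subst hab
    have hvw : bitsToNat v = bitsToNat w := by omega
    rw [bits_eq_of_bitsToNat_eq' h hvw]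

/-- The number of `b`-bit strings whose numeral is below `t ≤ 2^b` is exactly `t`. [folklore] -/
theorem card_filter_bitsToNat_lt {b t : ℕ} (ht : t ≤ 2 ^ b) :
    ((Finset.univ : Finset (List.Vector Bool b)).filter fun v => bitsToNat v.toList < t).card = t := by
  classical
  -- `bitsToNat` is a bijection from `{0,1}^b` onto `[0, 2^b)`
  have hinj : Function.Injective fun v : List.Vector Bool b => bitsToNat v.toList := fun v w hvw =>
    List.Vector.toList_injective (bits_eq_of_bitsToNat_eq' (by rw [v.toList_length, w.toList_length]) hvw)
  have himg : ((Finset.univ : Finset (List.Vector Bool b)).image fun v => bitsToNat v.toList) = Finset.range (2 ^ b) := by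
    apply Finset.eq_of_subset_of_card_le
    · intro i hi
      obtain ⟨v, _, rfl⟩ := Finset.mem_image.1 hi
      exact Finset.mem_range.2 (by have := bitsToNat_lt v.toList; rwa [v.toList_length] at this)
    · rw [Finset.card_range, Finset.card_image_of_injective _ hinj, Finset.card_univ, card_vector, Fintype.card_bool]
  calc ((Finset.univ : Finset (List.Vector Bool b)).filter fun v => bitsToNat v.toList < t).card
      = (((Finset.univ : Finset (List.Vector Bool b)).filter fun v => bitsToNat v.toList < t).image fun v => bitsToNat v.toList).card :=
        (Finset.card_image_of_injOn fun v _ w _ h => hinj h).symm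
    _ = ((Finset.range (2 ^ b)).filter fun i => i < t).card := by
        rw [← himg, Finset.filter_image]
    _ = (Finset.range t).card := by
        congr 1; ext i; simp only [Finset.mem_filter, Finset.mem_range]; omega
    _ = t := Finset.card_range t

/-- **Averaging over the Bernoulli coins**: `E_{cb}[F(c(cb))] = p F(1) + (1 − p) F(0)` (`c = [⟦cb⟧ < t]`,
`t/2^b = p`). [cite: HastadImpagliazzoLevinLuby1999, Lemma 6.3.2 (proof: "c_j = 1 with probability pₙ")] -/
theorem avg_bernoulli (h : Q.Laws pmin) (F : Bool → ℝ) :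
    uniformAvg Q.b (fun cb => F (decide (bitsToNat cb < Q.t))) = Q.p * F true + (1 - Q.p) * F false := by
  classical
  rw [uniformAvg_eq_sum, ← h.density]
  have hsplit := Finset.sum_filter_add_sum_filter_not (Finset.univ : Finset (List.Vector Bool Q.b))
    (fun v => bitsToNat v.toList < Q.t) (fun v => F (decide (bitsToNat v.toList < Q.t)))
  rw [← hsplit]
  have h1 : ∑ v ∈ (Finset.univ : Finset (List.Vector Bool Q.b)).filter (fun v => bitsToNat v.toList < Q.t),
      F (decide (bitsToNat v.toList < Q.t)) = Q.t * F true := by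
    rw [Finset.sum_congr rfl fun v hv => by rw [decide_eq_true (Finset.mem_filter.1 hv).2], Finset.sum_const, nsmul_eq_mul,
      card_filter_bitsToNat_lt h.t_le]
  have h2 : ∑ v ∈ (Finset.univ : Finset (List.Vector Bool Q.b)).filter (fun v => ¬ bitsToNat v.toList < Q.t),
      F (decide (bitsToNat v.toList < Q.t)) = (2 ^ Q.b - Q.t : ℝ) * F false := by
    rw [Finset.sum_congr rfl fun v hv => by rw [decide_eq_false (Finset.mem_filter.1 hv).2], Finset.sum_const, nsmul_eq_mul]
    congr 1
    have hc := Finset.card_filter_add_card_filter_not (s := (Finset.univ : Finset (List.Vector Bool Q.b)))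
      (fun v => bitsToNat v.toList < Q.t)
    rw [card_filter_bitsToNat_lt h.t_le, Finset.card_univ, card_vector, Fintype.card_bool] at hc
    have : ((Finset.univ : Finset (List.Vector Bool Q.b)).filter fun v => ¬ bitsToNat v.toList < Q.t).card = 2 ^ Q.b - Q.t := by omega
    rw [this, Nat.cast_sub h.t_le]; push_cast; ring
  rw [h1, h2]
  have h2b : (2 : ℝ) ^ Q.b ≠ 0 := pow_ne_zero _ two_ne_zero
  field_simp

/-! ### Analysis (b): one stage -/

section Stage

variable (τ : List (List Bool × Bool))

/-- The relevant set: `𝒯̃` for `c = 1`, `𝒯̃ᶜ` for `c = 0`. [folklore] -/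
def Sc (c : Bool) : Finset (List.Vector Bool N) := if c then Q.Tt else Q.Ttᶜ
/-- The relevant mean: `V₁` for `c = 1`, `V₀` for `c = 0`. [folklore] -/
noncomputable def Vc (c : Bool) : ℝ := if c then Q.V₁ τ else Q.V₀ τ

/-- `Vc = (Σ_{Sc} δ_c) / #Sc`. [folklore] -/
theorem Vc_eq (c : Bool) : Q.Vc τ c = (∑ w ∈ Q.Sc c, Q.δc τ w.toList c) / (Q.Sc c).card := by
  cases c <;> rfl

/-- `|Vc| ≤ 1`. [folklore] -/
theorem abs_Vc_le (h : Q.Laws pmin) (c : Bool) : Q.Vc τ c ≤ 1 := by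
  rw [Vc_eq]
  rcases (Q.Sc c).eq_empty_or_nonempty with h0 | hne
  · rw [h0]; simp
  · have hpos : (0 : ℝ) < (Q.Sc c).card := by exact_mod_cast hne.card_pos
    rw [div_le_one hpos]
    calc ∑ w ∈ Q.Sc c, Q.δc τ w.toList c ≤ ∑ _w ∈ Q.Sc c, (1 : ℝ) := Finset.sum_le_sum fun w _ => (abs_le.1 (h.abs_le _)).2
      _ = (Q.Sc c).card := by rw [Finset.sum_const, nsmul_eq_mul, mul_one]

/-- `#Sc ≥ pmin · 2^N`. [folklore] -/
theorem card_Sc_ge (h : Q.Laws pmin) (c : Bool) : pmin * 2 ^ N ≤ ((Q.Sc c).card : ℝ) := by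
  have h2 : (0 : ℝ) < 2 ^ N := by positivity
  cases c
  · have := h.pmin_le'
    rw [← card_compl_div Q, le_div_iff₀ h2] at this
    exact this
  · have := h.pmin_le
    unfold p at this
    rw [le_div_iff₀ h2] at this
    exact this

/-- A good candidate: in the relevant set with `δ_c ≥ Vc − ρ`. [cite: HastadImpagliazzoLevinLuby1999, Lemma 6.3.2 (proof of (b))] -/
def GoodW (c : Bool) (w : List Bool) : Prop := ∃ v : List.Vector Bool N, v.toList = w ∧ v ∈ Q.Sc c ∧ Q.Vc τ c - Q.ρ ≤ Q.δc τ w c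

/-- An accurate estimate for the candidate block `w ‖ ce`. [cite: HastadImpagliazzoLevinLuby1999, Lemma 6.3.2 (proof: "Δ is within ρ of the corresponding δ")] -/
def Accurate (c : Bool) (β : List Bool) : Prop := |Q.est τ (β.take N, c) (β.drop N) - Q.δc τ (β.take N) c| ≤ Q.ρ

/-- **Enough good candidates**: a `ρ/3` fraction of the relevant set is good (sampling lemma), so a uniform block
is good with probability `≥ pmin ρ / 3`. [cite: HastadImpagliazzoLevinLuby1999, Lemma 6.3.2 (proof of (b))] -/
theorem avg_goodW_ge (h : Q.Laws pmin) (c : Bool) : pmin * Q.ρ / 3 ≤ uniformAvg (N + Q.cE) fun β => ind (Q.GoodW τ c (β.take N)) := by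
  classical
  rw [uniformAvg_take N Q.cE fun w => ind (Q.GoodW τ c w), uniformAvg_eq_sum]
  have hne : (Q.Sc c).Nonempty := by cases c; exacts [h.Ttc_nonempty, h.Tt_nonempty]
  have hsl := sampling_lemma (Q.Sc c) hne (fun w => Q.δc τ w.toList c) (fun w _ => h.abs_le _) h.ρ_le
  rw [← Vc_eq] at hsl
  have h2 : (0 : ℝ) < 2 ^ N := by positivity
  rw [le_div_iff₀ h2]
  -- the good vectors are counted by the indicator sum
  have hcount : (((Q.Sc c).filter fun w => Q.Vc τ c - Q.ρ ≤ Q.δc τ w.toList c).card : ℝ) ≤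
      ∑ w : List.Vector Bool N, ind (Q.GoodW τ c w.toList) := by
    rw [← Finset.sum_filter_add_sum_filter_not Finset.univ fun w : List.Vector Bool N => Q.GoodW τ c w.toList]
    have h1 : ∑ w ∈ Finset.univ.filter (fun w : List.Vector Bool N => Q.GoodW τ c w.toList), ind (Q.GoodW τ c w.toList) =
        ((Finset.univ.filter fun w : List.Vector Bool N => Q.GoodW τ c w.toList).card : ℝ) := by
      rw [Finset.sum_congr rfl fun w hw => ind_of_true (Finset.mem_filter.1 hw).2, Finset.sum_const, nsmul_eq_mul, mul_one]
    have h0 : ∑ w ∈ Finset.univ.filter (fun w : List.Vector Bool N => ¬ Q.GoodW τ c w.toList), ind (Q.GoodW τ c w.toList) = 0 :=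
      Finset.sum_eq_zero fun w hw => ind_of_false (Finset.mem_filter.1 hw).2
    rw [h1, h0, add_zero]
    exact_mod_cast Finset.card_le_card fun w hw => by
      rw [Finset.mem_filter] at hw ⊢
      exact ⟨Finset.mem_univ _, w, rfl, hw.1, hw.2⟩
  calc pmin * Q.ρ / 3 * 2 ^ N = Q.ρ / 3 * (pmin * 2 ^ N) := by ring
    _ ≤ Q.ρ / 3 * (Q.Sc c).card := mul_le_mul_of_nonneg_left (card_Sc_ge h c) (div_nonneg h.ρ_nonneg (by norm_num))
    _ ≤ _ := hsl.trans hcount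

/-- **Few inaccurate estimates**: a uniform block is inaccurate with probability `≤ η`. [cite: HastadImpagliazzoLevinLuby1999, Lemma 6.3.2 (proof: "Pr[|Δ − δ| > ρ] ≤ 2^{-n}")] -/
theorem avg_inaccurate_le (h : Q.Laws pmin) (c : Bool) : uniformAvg (N + Q.cE) (fun β => ind (¬ Q.Accurate τ c β)) ≤ Q.η := by
  classical
  have hsplit : uniformAvg (N + Q.cE) (fun β => ind (¬ Q.Accurate τ c β)) =
      uniformAvg N fun w => uniformAvg Q.cE fun ce => ind (Q.ρ < |Q.est τ (w, c) ce - Q.δc τ w c|) := by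
    rw [← uniformAvg_add N Q.cE fun w ce => ind (Q.ρ < |Q.est τ (w, c) ce - Q.δc τ w c|)]
    refine uniformAvg_congr fun β hβ => ?_
    unfold Accurate; rw [not_le]
  rw [hsplit]
  exact (uniformAvg_mono fun w hw => h.est_good τ w c hw).trans (le_of_eq (uniformAvg_const N Q.η))

/-- **On the good events the greedy choice is good**: if some candidate block is good and every estimate is
accurate, the chosen candidate has `δ_c ≥ Vc − 3ρ`. [cite: HastadImpagliazzoLevinLuby1999, Lemma 6.3.2 (proof of (b): "δ_c(w_{m₀}) ≥ Δ_c(w_{m₀}) − ρ = max Δ − ρ ≥ max δ − 2ρ ≥ … − 3ρ")] -/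
theorem delta_pick_ge {c : Bool} {rest : List Bool}
    (hE₁ : ∃ m < Q.τn, Q.GoodW τ c ((blkL (N + Q.cE) m rest).take N))
    (hE₂ : ∀ m < Q.τn, Q.Accurate τ c (blkL (N + Q.cE) m rest)) :
    Q.Vc τ c - 3 * Q.ρ ≤ Q.δc τ ((blkL (N + Q.cE) (argmaxFirst (fun m => Q.est τ ((blkL (N + Q.cE) m rest).take N, c)
      ((blkL (N + Q.cE) m rest).drop N)) Q.τn) rest).take N) c := by
  set v : ℕ → ℝ := fun m => Q.est τ ((blkL (N + Q.cE) m rest).take N, c) ((blkL (N + Q.cE) m rest).drop N) with hv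
  obtain ⟨m₁, hm₁, hgood⟩ := hE₁
  set m₀ := argmaxFirst v Q.τn with hm₀
  have hτ : 0 < Q.τn := Nat.pos_of_ne_zero fun h0 => by rw [h0] at hm₁; exact Nat.not_lt_zero _ hm₁
  have hm₀lt : m₀ < Q.τn := argmaxFirst_lt v hτ
  have hmax : v m₁ ≤ v m₀ := le_argmaxFirst v Q.τn m₁ hm₁
  have ha₀ := hE₂ m₀ hm₀lt
  have ha₁ := hE₂ m₁ hm₁
  unfold Accurate at ha₀ ha₁
  obtain ⟨-, -, -, hg⟩ := hgood
  rw [abs_le] at ha₀ ha₁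
  have e0 : Q.est τ ((blkL (N + Q.cE) m₀ rest).take N, c) ((blkL (N + Q.cE) m₀ rest).drop N) = v m₀ := rfl
  have e1 : Q.est τ ((blkL (N + Q.cE) m₁ rest).take N, c) ((blkL (N + Q.cE) m₁ rest).drop N) = v m₁ := rfl
  rw [e0] at ha₀; rw [e1] at ha₁
  linarith [ha₀.1, ha₁.2]

/-- The index the stage picks, read off the candidate blocks `rest` for a fixed Bernoulli bit `c`. [folklore] -/
noncomputable def pickIdx (c : Bool) (rest : List Bool) : ℕ :=
  argmaxFirst (fun m => Q.est τ ((blkL (N + Q.cE) m rest).take N, c) ((blkL (N + Q.cE) m rest).drop N)) Q.τn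

/-- The candidate the stage picks. [folklore] -/
noncomputable def pickW (c : Bool) (rest : List Bool) : List Bool := (blkL (N + Q.cE) (Q.pickIdx τ c rest) rest).take N

/-- **The stage on `cb ‖ rest`**: the Bernoulli bit is read off `cb` (`|cb| = b`) and the pick off `rest`. [folklore] -/
theorem stage_append {cb : List Bool} (hcb : cb.length = Q.b) (rest : List Bool) :
    Q.stage τ (cb ++ rest) = τ ++ [(Q.pickW τ (decide (bitsToNat cb < Q.t)) rest, decide (bitsToNat cb < Q.t))] := by
  have hc : Q.cOf (cb ++ rest) = decide (bitsToNat cb < Q.t) := by rw [cOf, List.take_left' hcb]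
  have hblk : ∀ m, Q.blockOf (cb ++ rest) m = blkL (N + Q.cE) m rest := fun m => by rw [blockOf, List.drop_left' hcb, blkL]
  have hcand : ∀ m, Q.cand (cb ++ rest) m = (blkL (N + Q.cE) m rest).take N := fun m => by rw [cand, hblk]
  have hce : ∀ m, Q.ceOf (cb ++ rest) m = (blkL (N + Q.cE) m rest).drop N := fun m => by rw [ceOf, hblk]
  have hest : Q.estv τ (cb ++ rest) = fun m => Q.est τ ((blkL (N + Q.cE) m rest).take N, decide (bitsToNat cb < Q.t)) ((blkL (N + Q.cE) m rest).drop N) :=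
    funext fun m => by rw [estv, hcand, hce, hc]
  rw [stage, choice, hest, hc, hcand]
  rfl

set_option maxHeartbeats 800000 in
/-- **Analysis (b) for one stage and a fixed Bernoulli bit**:
`E_rest[δ_c(τ, pick)] ≥ Vc − 3ρ − 2((1 − pmin ρ/3)^{τn} + τn η)`. [cite: HastadImpagliazzoLevinLuby1999, Lemma 6.3.2 (proof of (b): "E[δ_c^{(j+1)}] ≥ max{…} − 4ρ")] -/
theorem stage_rest_ge (h : Q.Laws pmin) (c : Bool) :
    Q.Vc τ c - 3 * Q.ρ - 2 * ((1 - pmin * Q.ρ / 3) ^ Q.τn + Q.τn * Q.η) ≤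
      uniformAvg (Q.τn * (N + Q.cE)) fun rest => Q.δc τ (Q.pickW τ c rest) c := by
  classical
  set L := N + Q.cE with hL
  set E₁ : List Bool → Prop := fun rest => ∃ m < Q.τn, Q.GoodW τ c ((blkL L m rest).take N) with hE₁
  set E₂ : List Bool → Prop := fun rest => ∀ m < Q.τn, Q.Accurate τ c (blkL L m rest) with hE₂
  set K := Q.Vc τ c - 3 * Q.ρ with hK
  have hK1 : K ≤ 1 := by have := Q.abs_Vc_le τ h c; have := h.ρ_nonneg; rw [hK]; linarith
  -- pointwise lower bound
  have hpt : ∀ rest : List Bool, K * ind (E₁ rest ∧ E₂ rest) - ind (¬ (E₁ rest ∧ E₂ rest)) ≤ Q.δc τ (Q.pickW τ c rest) c := by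
    intro rest
    by_cases hE : E₁ rest ∧ E₂ rest
    · rw [ind_of_true hE, ind_of_false (not_not.2 hE), mul_one, sub_zero]
      exact Q.delta_pick_ge τ hE.1 hE.2
    · rw [ind_of_false hE, ind_of_true hE, mul_zero, zero_sub]
      exact (abs_le.1 (h.abs_le _)).1
  -- the failure probabilities
  have hq₁ : uniformAvg (Q.τn * L) (fun rest => ind (¬ E₁ rest)) ≤ (1 - pmin * Q.ρ / 3) ^ Q.τn := by
    have heq : (fun rest => ind (¬ E₁ rest)) = fun rest => ind (∀ m < Q.τn, ¬ Q.GoodW τ c ((blkL L m rest).take N)) :=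
      funext fun rest => by rw [hE₁]; simp only [not_exists, not_and]
    rw [heq, uniformAvg_forall_blkL L fun β => ¬ Q.GoodW τ c (β.take N)]
    have h0 : 0 ≤ uniformAvg L fun β => ind (¬ Q.GoodW τ c (β.take N)) := uniformAvg_nonneg fun _ => ind_nonneg _
    refine pow_le_pow_left₀ h0 ?_ _
    have hg := Q.avg_goodW_ge τ h c
    have hnot : uniformAvg L (fun β => ind (¬ Q.GoodW τ c (β.take N))) = 1 - uniformAvg L fun β => ind (Q.GoodW τ c (β.take N)) := by
      rw [← uniformAvg_const L (1 : ℝ), ← uniformAvg_sub_fun]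
      exact uniformAvg_congr fun β _ => ind_not _
    rw [hnot, hL]; linarith
  have hq₂ : uniformAvg (Q.τn * L) (fun rest => ind (¬ E₂ rest)) ≤ Q.τn * Q.η := by
    have heq : ∀ rest, ind (¬ E₂ rest) = ind (∃ m < Q.τn, ¬ Q.Accurate τ c (blkL L m rest)) := fun rest => by
      rw [hE₂]; congr 1; simp only [not_forall, exists_prop]
    calc uniformAvg (Q.τn * L) (fun rest => ind (¬ E₂ rest))
        ≤ uniformAvg (Q.τn * L) fun rest => ∑ m ∈ Finset.range Q.τn, ind (¬ Q.Accurate τ c (blkL L m rest)) :=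
          uniformAvg_mono fun rest _ => by rw [heq]; exact ind_exists_le _ _
      _ = ∑ m ∈ Finset.range Q.τn, uniformAvg (Q.τn * L) fun rest => ind (¬ Q.Accurate τ c (blkL L m rest)) := uniformAvg_finset_sum _ _ _
      _ = ∑ m ∈ Finset.range Q.τn, uniformAvg L fun β => ind (¬ Q.Accurate τ c β) :=
          Finset.sum_congr rfl fun m hm => uniformAvg_blkL (Finset.mem_range.1 hm) (fun β => ind (¬ Q.Accurate τ c β))
      _ ≤ ∑ _m ∈ Finset.range Q.τn, Q.η := Finset.sum_le_sum fun m _ => by rw [hL]; exact Q.avg_inaccurate_le τ h c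
      _ = Q.τn * Q.η := by rw [Finset.sum_const, Finset.card_range, nsmul_eq_mul]
  -- assemble
  set q := uniformAvg (Q.τn * L) fun rest => ind (¬ (E₁ rest ∧ E₂ rest)) with hq
  have hq0 : 0 ≤ q := uniformAvg_nonneg fun _ => ind_nonneg _
  have hqle : q ≤ (1 - pmin * Q.ρ / 3) ^ Q.τn + Q.τn * Q.η := by
    refine le_trans (uniformAvg_mono fun rest _ => ?_) (le_trans (le_of_eq (uniformAvg_add_fun _ _ _)) (add_le_add hq₁ hq₂))
    show ind (¬ (E₁ rest ∧ E₂ rest)) ≤ ind (¬ E₁ rest) + ind (¬ E₂ rest)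
    by_cases h1 : E₁ rest <;> by_cases h2 : E₂ rest <;> simp [ind, h1, h2]
  have havg : K * (1 - q) - q ≤ uniformAvg (Q.τn * L) fun rest => Q.δc τ (Q.pickW τ c rest) c := by
    have hlin : uniformAvg (Q.τn * L) (fun rest => K * ind (E₁ rest ∧ E₂ rest) - ind (¬ (E₁ rest ∧ E₂ rest))) = K * (1 - q) - q := by
      rw [uniformAvg_sub_fun, uniformAvg_const_mul, hq]
      congr 2
      rw [← uniformAvg_const (Q.τn * L) (1 : ℝ), ← uniformAvg_sub_fun]
      exact uniformAvg_congr fun rest _ => by rw [← ind_not, not_not]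
    rw [← hlin]
    exact uniformAvg_mono fun rest _ => hpt rest
  have hfin : K - 2 * q ≤ K * (1 - q) - q := by nlinarith
  rw [hL] at havg
  linarith

/-- **Analysis (b) for one stage**: `E_stage[δ(stage τ)] ≥ p V₁(τ) + (1 − p) V₀(τ) − 3ρ − 2((1 − pmin ρ/3)^{τn} + τn η)`.
[cite: HastadImpagliazzoLevinLuby1999, Lemma 6.3.2 (proof of (b): "E[δ^{(j+1)}] ≥ pₙ E[δ₁(W)] + (1 − pₙ) E[δ₀(W̄)] − 4ρ")] -/
theorem stage_ge (h : Q.Laws pmin) :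
    Q.p * Q.V₁ τ + (1 - Q.p) * Q.V₀ τ - 3 * Q.ρ - 2 * ((1 - pmin * Q.ρ / 3) ^ Q.τn + Q.τn * Q.η) ≤
      uniformAvg Q.cS fun cc => Q.δ (Q.stage τ cc) := by
  set K₀ := 3 * Q.ρ + 2 * ((1 - pmin * Q.ρ / 3) ^ Q.τn + Q.τn * Q.η) with hK₀
  have hsplit : uniformAvg Q.cS (fun cc => Q.δ (Q.stage τ cc)) =
      uniformAvg Q.b fun cb => uniformAvg (Q.τn * (N + Q.cE)) fun rest =>
        Q.δc τ (Q.pickW τ (decide (bitsToNat cb < Q.t)) rest) (decide (bitsToNat cb < Q.t)) := by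
    unfold cS
    rw [← uniformAvg_add Q.b (Q.τn * (N + Q.cE)) fun cb rest =>
      Q.δc τ (Q.pickW τ (decide (bitsToNat cb < Q.t)) rest) (decide (bitsToNat cb < Q.t))]
    refine uniformAvg_congr fun cc hcc => ?_
    have hcb : (cc.take Q.b).length = Q.b := by rw [List.length_take, hcc]; exact min_eq_left (Nat.le_add_right _ _)
    conv_lhs => rw [← List.take_append_drop Q.b cc]
    rw [Q.stage_append τ hcb, δc]
  rw [hsplit]
  have hlow : ∀ cb : List Bool, cb.length = Q.b →
      Q.Vc τ (decide (bitsToNat cb < Q.t)) - K₀ ≤ uniformAvg (Q.τn * (N + Q.cE)) fun rest =>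
        Q.δc τ (Q.pickW τ (decide (bitsToNat cb < Q.t)) rest) (decide (bitsToNat cb < Q.t)) := fun cb _ => by
    have := Q.stage_rest_ge τ h (decide (bitsToNat cb < Q.t)); rw [hK₀]; linarith
  refine le_trans (le_of_eq ?_) (uniformAvg_mono hlow)
  rw [Q.avg_bernoulli h fun c => Q.Vc τ c - K₀]
  simp only [Vc, if_true, Bool.false_eq_true, if_false]
  ring

/-- **The per-stage drop**: `δ(τ) − E_stage[δ(stage τ)] ≤ p ε(τ) + ρ'` with
`ρ' = 3ρ + 2((1 − pmin ρ/3)^{τn} + τn η)`. [cite: HastadImpagliazzoLevinLuby1999, Lemma 6.3.2 (proof, (b): "E[δ^{(j)} − δ^{(j+1)}] ≤ ε^{(j)} + 4ρ")] -/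
theorem stage_drop (h : Q.Laws pmin) :
    Q.δ τ - uniformAvg Q.cS (fun cc => Q.δ (Q.stage τ cc)) ≤ Q.p * Q.ε τ + (3 * Q.ρ + 2 * ((1 - pmin * Q.ρ / 3) ^ Q.τn + Q.τn * Q.η)) := by
  have h1 := Q.stage_ge τ h
  have h2 := Q.delta_split h τ
  linarith

end Stage

/-! ### Telescoping over the stages -/

/-- `ρ' = 3ρ + 2((1 − pmin ρ/3)^{τn} + τn η)`: the per-stage error. [folklore] -/
noncomputable def ρ' (pmin : ℝ) : ℝ := 3 * Q.ρ + 2 * ((1 - pmin * Q.ρ / 3) ^ Q.τn + Q.τn * Q.η)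

/-- **Telescoping**: `E_k[δ] ≥ δ(∅) − p Σ_{j<k} E_j[ε] − k ρ'`. [cite: HastadImpagliazzoLevinLuby1999, Lemma 6.3.2 (proof: "δₙ − E[δ^{(kₙ)}] = Σⱼ E[δ^{(j)} − δ^{(j+1)}] ≤ 4kₙρ + E[Σⱼ ε^{(j)}]")] -/
theorem Ej_delta_ge (h : Q.Laws pmin) : ∀ k : ℕ,
    Q.δ [] - Q.p * ∑ j ∈ Finset.range k, Q.Ej j Q.ε - k * Q.ρ' pmin ≤ Q.Ej k Q.δ
  | 0 => by rw [Ej_zero, Finset.sum_range_zero]; simp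
  | k + 1 => by
    have ih := Ej_delta_ge h k
    have hstep : Q.Ej k (fun τ => Q.δ τ - Q.p * Q.ε τ - Q.ρ' pmin) ≤ Q.Ej (k + 1) Q.δ := by
      rw [Ej_succ]
      exact Q.Ej_mono k fun τ => by have := Q.stage_drop τ h; unfold ρ'; linarith
    have hlin : Q.Ej k (fun τ => Q.δ τ - Q.p * Q.ε τ - Q.ρ' pmin) = Q.Ej k Q.δ - Q.p * Q.Ej k Q.ε - Q.ρ' pmin := by
      rw [Ej_sub, Ej_sub, Ej_const_mul, Ej_const]
    rw [hlin] at hstep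
    rw [Finset.sum_range_succ]
    push_cast
    linarith

/-- **Some stage has a large real-versus-random gap on `𝒯̃`**: for `k ≥ 1` there is `j* < k` with
`E_{j*}[ε] ≥ (δ(∅) − E_k[δ] − k ρ')/(p k)`. This `j*` is the advice of the phase-2 machine.
[cite: HastadImpagliazzoLevinLuby1999, Lemma 6.3.2 (proof: inequality (9), E_j[ε^{(j)}]/2 ≥ ρ)] -/
theorem exists_good_stage (h : Q.Laws pmin) {k : ℕ} (hk : 0 < k) :
    ∃ j, j < k ∧ (Q.δ [] - Q.Ej k Q.δ - k * Q.ρ' pmin) / (Q.p * k) ≤ Q.Ej j Q.ε := by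
  have hsum := Q.Ej_delta_ge h k
  have hp := h.p_pos
  have hkR : (0 : ℝ) < k := by exact_mod_cast hk
  by_contra hno
  push Not at hno
  have hlt : ∑ j ∈ Finset.range k, Q.Ej j Q.ε < k * ((Q.δ [] - Q.Ej k Q.δ - k * Q.ρ' pmin) / (Q.p * k)) := by
    calc ∑ j ∈ Finset.range k, Q.Ej j Q.ε < ∑ _j ∈ Finset.range k, (Q.δ [] - Q.Ej k Q.δ - k * Q.ρ' pmin) / (Q.p * k) :=
          Finset.sum_lt_sum_of_nonempty ⟨0, Finset.mem_range.2 hk⟩ fun j hj => hno j (Finset.mem_range.1 hj)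
      _ = k * ((Q.δ [] - Q.Ej k Q.δ - k * Q.ρ' pmin) / (Q.p * k)) := by rw [Finset.sum_const, Finset.card_range, nsmul_eq_mul]
  have hmul := mul_lt_mul_of_pos_left hlt hp
  have heq : Q.p * (k * ((Q.δ [] - Q.Ej k Q.δ - k * Q.ρ' pmin) / (Q.p * k))) = Q.δ [] - Q.Ej k Q.δ - k * Q.ρ' pmin := by
    field_simp
  rw [heq] at hmul
  linarith

end Data

end Greedy

end HILL

end Literature.Computability.Cryptography
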